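import Summits.AtomisticToContinuum.Crystallization.Theorems.FrustrationRangeCertificatesPatternPricedCertificatesPrimalCore
import Summits.AtomisticToContinuum.Crystallization.Theorems.FrustrationRangeCertificatesPatternPricedCertificatesStubUnpricedMeanBound
import Summits.AtomisticToContinuum.Crystallization.Theorems.FrustrationRangeCertificatesPatternPricedCertificatesBridgeCompactness
import Summits.AtomisticToContinuum.Crystallization.Theorems.FrustrationRangeCertificatesPatternPricedCertificatesStubMeanToLaw
import Summits.AtomisticToContinuum.Crystallization.Theorems.FrustrationRangeCertificatesPatternPricedCertificatesStubCampbellToStationary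
import Summits.AtomisticToContinuum.Crystallization.Theorems.FrustrationRangeCertificatesPatternPricedCertificatesStubLawEnergy
import Summits.AtomisticToContinuum.Crystallization.Theorems.FrustrationRangeCertificatesPatternPricedCertificatesStubLawBack
import Summits.AtomisticToContinuum.Crystallization.Theorems.PalmUnimodularRigidityBenjaminiSchrammLimitEmbedding
import Summits.AtomisticToContinuum.Crystallization.Theses.PalmUnimodularRigidity
import Literature.MathematicalPhysics.StatisticalMechanics.BarlowStacking
import Literature.Probability.Process.RootedHardCoreVague
import Literature.Probability.Process.PointStationaryLaw

/-!
# Crux `PatternPricedCertificates` (stmt-AtomisticToContinuum-12974), line `registered`: the σ-additive bridge (conditional)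

`PatternPricedCertificates` from `PalmRigidity` (stmt-9224), the uniqueness of the optimal Lennard-Jones hcp parameters (stub B5) and the
Campbell identity of represented mean families (stub B2a), over the landed bridge stubs B1 `stub_meanToLaw`, B2b `stub_campbellToStationary`,
B3 `stub_lawEnergy`, B6 `stub_lawBack`, the proved push-forward lemma `bridge_lawToPalm` and finite embedding `bridge_exists_finiteEmbedding`:
a point-stationary mean family of minimal energy is represented by a point-stationary probability law of minimal energy on the compact space
`RootedHardCoreConfig ℝ³ δ`, which `PalmRigidity` makes a.s. an exactly minimising rotated hcp stacking, hence (uniqueness) a rotated copy of one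
periodic `P`, and the almost-sure exact structure transfers back to vanishing defect mass of the mean family. All `[folklore]`.
-/

noncomputable section

open scoped BigOperators Classical
open MeasureTheory

namespace Summit.AtomisticToContinuum.Crystallization.Theorems.PatternPricedCertificates

open Literature.Probability.PointProcesses (IsRootedPattern ballPattern lens reroot)
open Literature.MathematicalPhysics.StatisticalMechanics (lennardJones PeriodicConfiguration)
open Literature.Probability.Process

/-- **The finite embedding**: an admissible rooted pattern `T` (root at `0`, not listed) IS the rooted `δ`-hard-core
configuration `insert 0 T` (junk `{0}` on inadmissible finsets). [folklore] -/
theorem bridge_exists_finiteEmbedding {δ : ℝ} (_hδ : 0 < δ) :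
    ∃ ι : Finset (EuclideanSpace ℝ (Fin 3)) → LocalConfig.RootedHardCoreConfig (EuclideanSpace ℝ (Fin 3)) δ,
      ∀ (ρ : ℝ) (T : Finset (EuclideanSpace ℝ (Fin 3))), IsRootedPattern δ ρ T →
        ((↑(ι T).1 : Set (EuclideanSpace ℝ (Fin 3)))) = insert (0 : EuclideanSpace ℝ (Fin 3)) (↑T : Set (EuclideanSpace ℝ (Fin 3))) := by
  classical
  have hsing : (0 : EuclideanSpace ℝ (Fin 3)) ∈ (LocalConfig.mk ({0} : Set (EuclideanSpace ℝ (Fin 3)))) ∧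
      ∀ x ∈ (LocalConfig.mk ({0} : Set (EuclideanSpace ℝ (Fin 3)))), ∀ y ∈ (LocalConfig.mk ({0} : Set (EuclideanSpace ℝ (Fin 3)))),
        x ≠ y → δ ≤ dist x y := by
    refine ⟨by simp, fun x hx y hy hxy => ?_⟩
    simp only [LocalConfig.mem_mk, Set.mem_singleton_iff] at hx hy
    exact absurd (hx.trans hy.symm) hxy
  refine ⟨fun T => if h : ((0 : EuclideanSpace ℝ (Fin 3)) ∈ (LocalConfig.mk (insert (0 : EuclideanSpace ℝ (Fin 3)) (↑T : Set (EuclideanSpace ℝ (Fin 3))))) ∧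
      ∀ x ∈ (LocalConfig.mk (insert (0 : EuclideanSpace ℝ (Fin 3)) (↑T : Set (EuclideanSpace ℝ (Fin 3))))),
        ∀ y ∈ (LocalConfig.mk (insert (0 : EuclideanSpace ℝ (Fin 3)) (↑T : Set (EuclideanSpace ℝ (Fin 3))))), x ≠ y → δ ≤ dist x y)
      then ⟨_, h⟩ else ⟨_, hsing⟩, fun ρ T hT => ?_⟩
  have hadm : (0 : EuclideanSpace ℝ (Fin 3)) ∈ (LocalConfig.mk (insert (0 : EuclideanSpace ℝ (Fin 3)) (↑T : Set (EuclideanSpace ℝ (Fin 3))))) ∧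
      ∀ x ∈ (LocalConfig.mk (insert (0 : EuclideanSpace ℝ (Fin 3)) (↑T : Set (EuclideanSpace ℝ (Fin 3))))),
        ∀ y ∈ (LocalConfig.mk (insert (0 : EuclideanSpace ℝ (Fin 3)) (↑T : Set (EuclideanSpace ℝ (Fin 3))))), x ≠ y → δ ≤ dist x y := by
    refine ⟨by simp, fun x hx y hy hxy => ?_⟩
    simp only [LocalConfig.mem_mk, Set.mem_insert_iff, Finset.mem_coe] at hx hy
    rcases hx with rfl | hx
    · rcases hy with rfl | hy
      · exact absurd rfl hxy
      · rw [dist_eq_norm, zero_sub, norm_neg]; exact (hT.1 y hy).1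
    · rcases hy with rfl | hy
      · rw [dist_eq_norm, sub_zero]; exact (hT.1 x hx).1
      · rw [dist_eq_norm]; exact hT.2 x hx y hy hxy
  simp only [dif_pos hadm]
  rfl

/-- **Lemma B4 (push-forward to configurations-as-measures; proved).** For a probability law `Q` on rooted
`δ`-hard-core configurations, the push-forward `P = Q.map (S ↦ count|S)` along the measurable embedding
(`measurableEmbedding_toMeasure`) is a probability law, `P`-a.e. `μ` is the counting measure of a rooted `δ`-separated
set, mean root energies agree, and `count|S = count|X` forces `S = X`. [folklore] -/
theorem bridge_lawToPalm :
    ∀ δ : ℝ, 0 < δ → ∀ Q : MeasureTheory.Measure (Literature.Probability.Process.LocalConfig.RootedHardCoreConfig (EuclideanSpace ℝ (Fin 3)) δ), MeasureTheory.IsProbabilityMeasure Q →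
      MeasureTheory.IsProbabilityMeasure (Q.map (fun S : Literature.Probability.Process.LocalConfig.RootedHardCoreConfig (EuclideanSpace ℝ (Fin 3)) δ => Literature.Probability.Process.LocalConfig.toMeasure S.1)) ∧
      (∀ᵐ μ ∂(Q.map (fun S : Literature.Probability.Process.LocalConfig.RootedHardCoreConfig (EuclideanSpace ℝ (Fin 3)) δ => Literature.Probability.Process.LocalConfig.toMeasure S.1)), (∃ S : Set (EuclideanSpace ℝ (Fin 3)), (0 : (EuclideanSpace ℝ (Fin 3))) ∈ S ∧ (∀ x ∈ S, ∀ y ∈ S, x ≠ y → δ ≤ dist x y) ∧ μ = (MeasureTheory.Measure.count : MeasureTheory.Measure (EuclideanSpace ℝ (Fin 3))).restrict S)) ∧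
      (∫ μ, (∫ y, Literature.MathematicalPhysics.StatisticalMechanics.lennardJones ‖y‖ ∂μ) / 2 ∂(Q.map (fun S : Literature.Probability.Process.LocalConfig.RootedHardCoreConfig (EuclideanSpace ℝ (Fin 3)) δ => Literature.Probability.Process.LocalConfig.toMeasure S.1))) = ∫ S, (∫ y, Literature.MathematicalPhysics.StatisticalMechanics.lennardJones ‖y‖ ∂(Literature.Probability.Process.LocalConfig.toMeasure S.1)) / 2 ∂Q ∧
      (∀ (S : Literature.Probability.Process.LocalConfig.RootedHardCoreConfig (EuclideanSpace ℝ (Fin 3)) δ) (X : Set (EuclideanSpace ℝ (Fin 3))), Literature.Probability.Process.LocalConfig.toMeasure S.1 = (MeasureTheory.Measure.count : MeasureTheory.Measure (EuclideanSpace ℝ (Fin 3))).restrict X → ((↑S.1 : Set (EuclideanSpace ℝ (Fin 3)))) = X) := by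
  intro δ hδ Q hQ
  haveI : Fact (0 < δ) := ⟨hδ⟩
  have hemb := Summit.AtomisticToContinuum.Crystallization.Theorems.BenjaminiSchrammLimit.measurableEmbedding_toMeasure
    (EuclideanSpace ℝ (Fin 3)) (δ := δ)
  refine ⟨MeasureTheory.Measure.isProbabilityMeasure_map hemb.measurable.aemeasurable, ?_, hemb.integral_map _, ?_⟩
  · rw [hemb.ae_map_iff]
    filter_upwards with S
    exact ⟨(↑S.1 : Set (EuclideanSpace ℝ (Fin 3))), S.2.1, S.2.2, rfl⟩
  · intro S X h
    ext x
    rw [← Literature.Probability.Process.count_restrict_singleton_ne_zero_iff (↑S.1 : Set (EuclideanSpace ℝ (Fin 3))) x,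
      ← Literature.Probability.Process.count_restrict_singleton_ne_zero_iff X x,
      ← Literature.Probability.Process.LocalConfig.toMeasure_def, h]

/-- **The open core from the σ-additive Palm rigidity and hcp uniqueness** (composition of stubs B1–B6 with
`PalmRigidity`, stmt-AtomisticToContinuum-9224, taken as a hypothesis BY NAME). [folklore] -/
theorem bridge_qualitativeMeansRigidity_of_palm
    (h2a : ∀ δ : ℝ, 0 < δ → ∀ ι : Finset (EuclideanSpace ℝ (Fin 3)) → Literature.Probability.Process.LocalConfig.RootedHardCoreConfig (EuclideanSpace ℝ (Fin 3)) δ, (∀ (ρ : ℝ) (T : Finset (EuclideanSpace ℝ (Fin 3))), Literature.Probability.PointProcesses.IsRootedPattern δ ρ T → ((↑(ι T).1 : Set (EuclideanSpace ℝ (Fin 3)))) = insert (0 : (EuclideanSpace ℝ (Fin 3))) (↑T : Set (EuclideanSpace ℝ (Fin 3)))) → ∀ ℓ : ℝ → (Finset (EuclideanSpace ℝ (Fin 3)) → ℝ) → ℝ,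
      (∀ (ρ : ℝ) (f₁ f₂ : Finset (EuclideanSpace ℝ (Fin 3)) → ℝ), ℓ ρ (f₁ + f₂) = ℓ ρ f₁ + ℓ ρ f₂) →
      (∀ (ρ t : ℝ) (f : Finset (EuclideanSpace ℝ (Fin 3)) → ℝ), ℓ ρ (t • f) = t * ℓ ρ f) →
      (∀ (ρ : ℝ) (f : Finset (EuclideanSpace ℝ (Fin 3)) → ℝ), (∀ S : Finset (EuclideanSpace ℝ (Fin 3)), Literature.Probability.PointProcesses.IsRootedPattern δ ρ S → 0 ≤ f S ∧ f S ≤ 1) → 0 ≤ ℓ ρ f) →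
      (∀ ρ : ℝ, ℓ ρ (fun _ => 1) = 1) →
      (∀ ρ ρ' : ℝ, ρ ≤ ρ' → ∀ f : Finset (EuclideanSpace ℝ (Fin 3)) → ℝ, ℓ ρ' (fun S => f (Literature.Probability.PointProcesses.ballPattern ρ S)) = ℓ ρ f) →
      (∀ r ρ : ℝ, 0 ≤ r → ∀ g : (EuclideanSpace ℝ (Fin 3)) → Finset (EuclideanSpace ℝ (Fin 3)) → Finset (EuclideanSpace ℝ (Fin 3)) → ℝ, (∃ M : ℝ, ∀ v p q, |g v p q| ≤ M) → ℓ ρ (fun S => ∑ v ∈ Literature.Probability.PointProcesses.lens r ρ S, (g v (Literature.Probability.PointProcesses.ballPattern r S) (Literature.Probability.PointProcesses.ballPattern r (Literature.Probability.PointProcesses.reroot S v)) - g (-v) (Literature.Probability.PointProcesses.ballPattern r (Literature.Probability.PointProcesses.reroot S v)) (Literature.Probability.PointProcesses.ballPattern r S))) = 0) →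
      ∀ Q : MeasureTheory.Measure (Literature.Probability.Process.LocalConfig.RootedHardCoreConfig (EuclideanSpace ℝ (Fin 3)) δ), MeasureTheory.IsProbabilityMeasure Q →
      (∀ F : Literature.Probability.Process.LocalConfig.RootedHardCoreConfig (EuclideanSpace ℝ (Fin 3)) δ → ℝ, Continuous F → ∀ c : ℝ, ((∃ n₀ : ℕ, ∀ n : ℕ, n₀ ≤ n → c ≤ ℓ (n : ℝ) (fun T => F (ι T))) → c ≤ ∫ x, F x ∂Q) ∧ ((∃ n₀ : ℕ, ∀ n : ℕ, n₀ ≤ n → ℓ (n : ℝ) (fun T => F (ι T)) ≤ c) → ∫ x, F x ∂Q ≤ c)) →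
      ∀ G : Literature.Probability.Process.LocalConfig.RootedHardCoreConfig (EuclideanSpace ℝ (Fin 3)) δ × (EuclideanSpace ℝ (Fin 3)) → ℝ, Continuous G → (∃ R : ℝ, ∀ S y, R < ‖y‖ → G (S, y) = 0) →
        (∃ M : ℝ, ∀ p, |G p| ≤ M) →
        ∫ S, (∫ y, G (S, y) ∂(Literature.Probability.Process.LocalConfig.toMeasure S.1)) ∂Q =
          ∫ S, (∫ y, (if h : y ∈ ((↑S.1 : Set (EuclideanSpace ℝ (Fin 3)))) then G (S.reroot y h, -y) else 0) ∂(Literature.Probability.Process.LocalConfig.toMeasure S.1)) ∂Q)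
    (hU : ∃ P : Literature.MathematicalPhysics.StatisticalMechanics.PeriodicConfiguration 3, ∀ (a h : ℝ) (ha : a ≠ 0) (hh : h ≠ 0), 1 / 2 ≤ a → a ≤ 2 → 1 / 2 ≤ h → h ≤ 2 →
      (Literature.MathematicalPhysics.StatisticalMechanics.hcpPeriodicConfiguration ha hh).energyPerParticle Literature.MathematicalPhysics.StatisticalMechanics.lennardJones = (⨅ Q : Literature.MathematicalPhysics.StatisticalMechanics.PeriodicConfiguration 3, Q.energyPerParticle Literature.MathematicalPhysics.StatisticalMechanics.lennardJones) →
      ∃ L : (EuclideanSpace ℝ (Fin 3)) ≃ₗᵢ[ℝ] (EuclideanSpace ℝ (Fin 3)), (⇑L) '' P.points = Literature.MathematicalPhysics.StatisticalMechanics.hcpStacking a h)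
    (hPalm : Summit.AtomisticToContinuum.Crystallization.Theses.PalmUnimodularRigidity.PalmRigidity) :
    ∃ P : Literature.MathematicalPhysics.StatisticalMechanics.PeriodicConfiguration 3, ∀ δ : ℝ, 0 < δ → ∀ ℓ : ℝ → (Finset (EuclideanSpace ℝ (Fin 3)) → ℝ) → ℝ,
      (∀ (ρ : ℝ) (f₁ f₂ : Finset (EuclideanSpace ℝ (Fin 3)) → ℝ), ℓ ρ (f₁ + f₂) = ℓ ρ f₁ + ℓ ρ f₂) →
      (∀ (ρ t : ℝ) (f : Finset (EuclideanSpace ℝ (Fin 3)) → ℝ), ℓ ρ (t • f) = t * ℓ ρ f) →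
      (∀ (ρ : ℝ) (f : Finset (EuclideanSpace ℝ (Fin 3)) → ℝ), (∀ S : Finset (EuclideanSpace ℝ (Fin 3)), Literature.Probability.PointProcesses.IsRootedPattern δ ρ S → 0 ≤ f S ∧ f S ≤ 1) → 0 ≤ ℓ ρ f) →
      (∀ ρ : ℝ, ℓ ρ (fun _ => 1) = 1) →
      (∀ ρ ρ' : ℝ, ρ ≤ ρ' → ∀ f : Finset (EuclideanSpace ℝ (Fin 3)) → ℝ, ℓ ρ' (fun S => f (Literature.Probability.PointProcesses.ballPattern ρ S)) = ℓ ρ f) →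
      (∀ r ρ : ℝ, 0 ≤ r → ∀ g : EuclideanSpace ℝ (Fin 3) → Finset (EuclideanSpace ℝ (Fin 3)) → Finset (EuclideanSpace ℝ (Fin 3)) → ℝ, (∃ M : ℝ, ∀ v p q, |g v p q| ≤ M) →
        ℓ ρ (fun S => ∑ v ∈ Literature.Probability.PointProcesses.lens r ρ S, (g v (Literature.Probability.PointProcesses.ballPattern r S) (Literature.Probability.PointProcesses.ballPattern r (Literature.Probability.PointProcesses.reroot S v)) - g (-v) (Literature.Probability.PointProcesses.ballPattern r (Literature.Probability.PointProcesses.reroot S v)) (Literature.Probability.PointProcesses.ballPattern r S))) = 0) →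
      (∀ η : ℝ, 0 < η → ∃ ρ : ℝ, 1 ≤ ρ ∧ ℓ ρ (fun S => (∑ v ∈ S, Literature.MathematicalPhysics.StatisticalMechanics.lennardJones ‖v‖) / 2) ≤ (⨅ Q : Literature.MathematicalPhysics.StatisticalMechanics.PeriodicConfiguration 3, Q.energyPerParticle Literature.MathematicalPhysics.StatisticalMechanics.lennardJones) + η) →
      ∀ R ε : ℝ, 0 < R → 0 < ε →
        ℓ (R + ε) (fun S => (if (∃ A : EuclideanSpace ℝ (Fin 3) →ₗᵢ[ℝ] EuclideanSpace ℝ (Fin 3), (∀ p ∈ P.points, ‖p‖ ≤ R → ∃ v ∈ insert (0 : EuclideanSpace ℝ (Fin 3)) S, dist v (A p) ≤ ε) ∧ (∀ v ∈ insert (0 : EuclideanSpace ℝ (Fin 3)) S, ‖v‖ ≤ R → ∃ p ∈ P.points, dist v (A p) ≤ ε)) then (0 : ℝ) else 1)) = 0 := by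
  obtain ⟨P, hP⟩ := hU
  refine ⟨P, fun δ hδ ℓ H1 H2 H3 H4 H5 H6 H7 R ε hR hε => ?_⟩
  obtain ⟨ι, hι⟩ := bridge_exists_finiteEmbedding hδ
  obtain ⟨Q, hQ, hrepr⟩ := stub_meanToLaw δ hδ ι ℓ H1 H2 H3 H4
  have hstat := stub_campbellToStationary δ hδ Q hQ
    (h2a δ hδ ι hι ℓ H1 H2 H3 H4 H5 H6 Q hQ hrepr)
  have hener := stub_lawEnergy δ hδ ι hι ℓ H1 H2 H3 H4 H5 H7 Q hQ hrepr
  obtain ⟨hprob', hcore', hener', hinj⟩ := bridge_lawToPalm δ hδ Q hQ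
  have hconc := hPalm δ hδ _ hprob' hcore' hstat (by rw [hener']; exact hener)
  have hae : ∀ᵐ S ∂Q, ∃ L : EuclideanSpace ℝ (Fin 3) ≃ₗᵢ[ℝ] EuclideanSpace ℝ (Fin 3),
      ((↑S.1 : Set (EuclideanSpace ℝ (Fin 3)))) = (⇑L) '' P.points := by
    have hmeas : AEMeasurable (fun S : LocalConfig.RootedHardCoreConfig (EuclideanSpace ℝ (Fin 3)) δ =>
        LocalConfig.toMeasure S.1) Q := (LocalConfig.measurable_toMeasure hδ).aemeasurable
    filter_upwards [ae_of_ae_map hmeas hconc] with S hS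
    obtain ⟨a, h, ha, hh, ha1, ha2, hh1, hh2, A, heq, hμ⟩ := hS
    have hset := hinj S _ hμ
    obtain ⟨L, hL⟩ := hP a h ha hh ha1 ha2 hh1 hh2 heq
    refine ⟨L.trans A, ?_⟩
    rw [hset, ← hL, ← Set.image_comp]
    rfl
  exact stub_lawBack δ hδ ι hι ℓ H1 H2 H3 H4 H5 Q hQ hrepr P hae R ε hR hε

/-- **The crux from the σ-additive Palm rigidity and hcp uniqueness** (conditional result): `PatternPricedCertificates` BY NAME from
`PalmRigidity` (item stmt-AtomisticToContinuum-9224, the open target of route `PalmUnimodularRigidity`), the uniqueness of the optimal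
Lennard-Jones hcp parameters (`hU`, stub B5 of the line) and the Campbell identity of represented mean families (`h2a`, stub B2a) —
through the landed bridge stubs `stub_meanToLaw`, `stub_campbellToStationary`, `stub_lawEnergy`, `stub_lawBack`, the qualitative core
(`bridge_qualitativeMeansRigidity_of_palm`), the priced core (`bridge_stationaryMeansRigidity_of` with the landed unpriced bound
`stub_unpricedMeanBound`) and the landed primal-core assembly `patternPricedCertificates_of_stationaryMeansRigidity`. [folklore] -/
theorem patternPricedCertificates_of_palmRigidity :
    (∀ δ : ℝ, 0 < δ → ∀ ι : Finset (EuclideanSpace ℝ (Fin 3)) → Literature.Probability.Process.LocalConfig.RootedHardCoreConfig (EuclideanSpace ℝ (Fin 3)) δ, (∀ (ρ : ℝ) (T : Finset (EuclideanSpace ℝ (Fin 3))), Literature.Probability.PointProcesses.IsRootedPattern δ ρ T → ((↑(ι T).1 : Set (EuclideanSpace ℝ (Fin 3)))) = insert (0 : (EuclideanSpace ℝ (Fin 3))) (↑T : Set (EuclideanSpace ℝ (Fin 3)))) → ∀ ℓ : ℝ → (Finset (EuclideanSpace ℝ (Fin 3)) → ℝ) → ℝ,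
      (∀ (ρ : ℝ) (f₁ f₂ : Finset (EuclideanSpace ℝ (Fin 3)) → ℝ), ℓ ρ (f₁ + f₂) = ℓ ρ f₁ + ℓ ρ f₂) →
      (∀ (ρ t : ℝ) (f : Finset (EuclideanSpace ℝ (Fin 3)) → ℝ), ℓ ρ (t • f) = t * ℓ ρ f) →
      (∀ (ρ : ℝ) (f : Finset (EuclideanSpace ℝ (Fin 3)) → ℝ), (∀ S : Finset (EuclideanSpace ℝ (Fin 3)), Literature.Probability.PointProcesses.IsRootedPattern δ ρ S → 0 ≤ f S ∧ f S ≤ 1) → 0 ≤ ℓ ρ f) →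
      (∀ ρ : ℝ, ℓ ρ (fun _ => 1) = 1) →
      (∀ ρ ρ' : ℝ, ρ ≤ ρ' → ∀ f : Finset (EuclideanSpace ℝ (Fin 3)) → ℝ, ℓ ρ' (fun S => f (Literature.Probability.PointProcesses.ballPattern ρ S)) = ℓ ρ f) →
      (∀ r ρ : ℝ, 0 ≤ r → ∀ g : (EuclideanSpace ℝ (Fin 3)) → Finset (EuclideanSpace ℝ (Fin 3)) → Finset (EuclideanSpace ℝ (Fin 3)) → ℝ, (∃ M : ℝ, ∀ v p q, |g v p q| ≤ M) → ℓ ρ (fun S => ∑ v ∈ Literature.Probability.PointProcesses.lens r ρ S, (g v (Literature.Probability.PointProcesses.ballPattern r S) (Literature.Probability.PointProcesses.ballPattern r (Literature.Probability.PointProcesses.reroot S v)) - g (-v) (Literature.Probability.PointProcesses.ballPattern r (Literature.Probability.PointProcesses.reroot S v)) (Literature.Probability.PointProcesses.ballPattern r S))) = 0) →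
      ∀ Q : MeasureTheory.Measure (Literature.Probability.Process.LocalConfig.RootedHardCoreConfig (EuclideanSpace ℝ (Fin 3)) δ), MeasureTheory.IsProbabilityMeasure Q →
      (∀ F : Literature.Probability.Process.LocalConfig.RootedHardCoreConfig (EuclideanSpace ℝ (Fin 3)) δ → ℝ, Continuous F → ∀ c : ℝ, ((∃ n₀ : ℕ, ∀ n : ℕ, n₀ ≤ n → c ≤ ℓ (n : ℝ) (fun T => F (ι T))) → c ≤ ∫ x, F x ∂Q) ∧ ((∃ n₀ : ℕ, ∀ n : ℕ, n₀ ≤ n → ℓ (n : ℝ) (fun T => F (ι T)) ≤ c) → ∫ x, F x ∂Q ≤ c)) →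
      ∀ G : Literature.Probability.Process.LocalConfig.RootedHardCoreConfig (EuclideanSpace ℝ (Fin 3)) δ × (EuclideanSpace ℝ (Fin 3)) → ℝ, Continuous G → (∃ R : ℝ, ∀ S y, R < ‖y‖ → G (S, y) = 0) →
        (∃ M : ℝ, ∀ p, |G p| ≤ M) →
        ∫ S, (∫ y, G (S, y) ∂(Literature.Probability.Process.LocalConfig.toMeasure S.1)) ∂Q =
          ∫ S, (∫ y, (if h : y ∈ ((↑S.1 : Set (EuclideanSpace ℝ (Fin 3)))) then G (S.reroot y h, -y) else 0) ∂(Literature.Probability.Process.LocalConfig.toMeasure S.1)) ∂Q) →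
    (∃ P : Literature.MathematicalPhysics.StatisticalMechanics.PeriodicConfiguration 3, ∀ (a h : ℝ) (ha : a ≠ 0) (hh : h ≠ 0), 1 / 2 ≤ a → a ≤ 2 → 1 / 2 ≤ h → h ≤ 2 →
      (Literature.MathematicalPhysics.StatisticalMechanics.hcpPeriodicConfiguration ha hh).energyPerParticle Literature.MathematicalPhysics.StatisticalMechanics.lennardJones = (⨅ Q : Literature.MathematicalPhysics.StatisticalMechanics.PeriodicConfiguration 3, Q.energyPerParticle Literature.MathematicalPhysics.StatisticalMechanics.lennardJones) →
      ∃ L : (EuclideanSpace ℝ (Fin 3)) ≃ₗᵢ[ℝ] (EuclideanSpace ℝ (Fin 3)), (⇑L) '' P.points = Literature.MathematicalPhysics.StatisticalMechanics.hcpStacking a h) →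
    Summit.AtomisticToContinuum.Crystallization.Theses.PalmUnimodularRigidity.PalmRigidity →
    Summit.AtomisticToContinuum.Crystallization.Theses.FrustrationRangeCertificates.PatternPricedCertificates :=
  fun h2a hU hPalm => patternPricedCertificates_of_stationaryMeansRigidity
    (bridge_stationaryMeansRigidity_of (bridge_qualitativeMeansRigidity_of_palm h2a hU hPalm) stub_unpricedMeanBound)

end Summit.AtomisticToContinuum.Crystallization.Theorems.PatternPricedCertificates

end
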